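import Literature.Analysis.FluidPDE.OseenSlabPhysical
import HarnessLib

/-!
# Sup-norm perturbation theory of the Oseen integral equation on a time slab, V:
  weak divergence-freeness of the solution slices and equicontinuity of Duhamel slices

Analysis/FluidPDE file (definition `bcfOfBounded`; everything else proved).
* `slab_solution_isWeaklyDivFree` — the slices of the solution of the perturbation equation are
  weakly divergence free when the datum is (a posteriori: `B_a` of bounded fields and the heat
  flow of a weakly divergence-free bounded datum are weakly divergence free, and
  `w = e^{(·-a)Δ}g − L w − B_a(w,w)`);
* `exists_forall_norm_oseenDuhamel_sub_le_space` — a modulus of continuity in space of the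
  Duhamel term `B_s(p,q)(t)` of bounded measurable fields depending only on the bounds and on
  `s < t ≤ T` (semigroup split `B_s(t) = e^{θΔ}B_s(t−θ) + B_{t−θ}(t)` plus the Lipschitz bound of
  the heat flow of bounded data), i.e. the equicontinuity behind the compactness of the Duhamel
  part of the linearised period map (Arzelà–Ascoli modulo tails);
* `bcfOfBounded` (definition) — the total wrapper turning a continuous bounded bare function into
  a bounded continuous function, with its algebra.

## References

* G. Koch, N. Nadirashvili, G. Seregin, V. Šverák, *Liouville theorems for the Navier–Stokes
  equations and applications*, Acta Math. 203 (2009) = arXiv:0709.3599, §4 (4.3)–(4.4)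
  (`u = U + B(u,u)` solved on `L^∞` by a fixed point; `‖B(u,v)‖ ≤ C√T‖u‖‖v‖`).
  [KochNadirashviliSereginSverak2009]
* M. P. Coiculescu, S. Palasek, Invent. Math. 244 (2025) = arXiv:2503.14699, App. B, Prop. B.1
  (the linearised problem in the exponentially weighted sup norm). [CoiculescuPalasek2025]
* D. Henry, *Geometric Theory of Semilinear Parabolic Equations*, LNM 840 (1981), §3.3–3.4
  (differentiable dependence on the data). [Henry1981]
* P. G. Lemarié-Rieusset, *The Navier–Stokes Problem in the 21st Century* (2016), Thm. 9.12,
  proof, (9.38). [LemarieRieusset2016]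
-/

noncomputable section

open MeasureTheory Set Function Filter
open _root_.Topology
open scoped BoundedContinuousFunction

namespace Literature.Analysis.FluidPDE

variable {E : Type*} [NormedAddCommGroup E] [InnerProductSpace ℝ E] [FiniteDimensional ℝ E]
  [MeasurableSpace E] [BorelSpace E]

/-! ### Weak divergence-freeness of the solution slices; equicontinuity of Duhamel slices -/

section Qualitative

variable {a b : ℝ} (hab : a ≤ b)

/-- A slice of the Duhamel term of two slab fields is weakly divergence free. [folklore] -/
theorem isWeaklyDivFree_oseenDuhamel_slabPhys (W₁ W₂ : (Icc a b) × E →ᵇ E) {s t : ℝ}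
    (ht : t ≤ b) :
    IsWeaklyDivFree (oseenDuhamel 1 s (slabPhys hab W₁) (slabPhys hab W₂) t) := by
  rcases le_or_gt t s with hts | hst
  · have : oseenDuhamel 1 s (slabPhys hab W₁) (slabPhys hab W₂) t = 0 := by
      funext x; exact oseenDuhamel_eq_zero_of_le hts x
    rw [this]; exact isWeaklyDivFree_zero_pi
  exact isWeaklyDivFree_oseenDuhamel one_pos (T := b) (M := max ‖W₁‖ ‖W₂‖)
    (aestronglyMeasurable_uncurry_slabPhys hab W₁ _) (aestronglyMeasurable_uncurry_slabPhys hab W₂ _)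
    (le_max_of_le_left (norm_nonneg _))
    (fun τ _ y => (norm_slabPhys_le hab W₁ τ y).trans (le_max_left _ _))
    (fun τ _ y => (norm_slabPhys_le hab W₂ τ y).trans (le_max_right _ _)) hst ht

/-- The slices of the heat flow of bounded continuous weakly divergence-free data are weakly
divergence free (for every time, the flow being the identity at nonpositive times). [folklore] -/
theorem isWeaklyDivFree_heatFlow_of_bound {g : E → E} (hdiv : IsWeaklyDivFree g) (hgc : Continuous g)
    {C : ℝ} (hC : ∀ z, ‖g z‖ ≤ C) (σ : ℝ) : IsWeaklyDivFree (heatFlow g σ) := by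
  rcases le_or_gt σ 0 with hσ | hσ
  · rw [heatFlow_of_nonpos _ hσ]; exact hdiv
  · rw [heatFlow_of_pos _ hσ]
    exact hdiv.heatExtension_of_bound hgc.aestronglyMeasurable hC hσ

omit [FiniteDimensional ℝ E] [MeasurableSpace E] [BorelSpace E] in
/-- Continuity of a slice of a slab field read through `slabPhys`. [folklore] -/
theorem continuous_slabPhys_slice (W : (Icc a b) × E →ᵇ E) (t : ℝ) : Continuous (slabPhys hab W t) := by
  by_cases ht : t ∈ Icc a b
  · rw [slabPhys_eq_slabSlice hab W ht]; exact (slabSlice W ⟨t, ht⟩).continuous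
  · have : slabPhys hab W t = 0 := by funext x; exact slabPhys_of_not_mem hab W ht x
    rw [this]; exact continuous_zero

/-- **The slices of the solution of the perturbation equation are weakly divergence free** when the
datum is: `w(t) = e^{(t-a)Δ}g − L_a[U](w)(t) − B_a(w,w)(t)` and each term is weakly divergence free
(`IsWeaklyDivFree.heatExtension_of_bound`, `isWeaklyDivFree_oseenDuhamel`). [folklore] -/
theorem slab_solution_isWeaklyDivFree {U w : (Icc a b) × E →ᵇ E} {g : E →ᵇ E}
    (heq : w + slabLin hab U w + slabBilin hab w w = slabHeat g) (hg : IsWeaklyDivFree (⇑g))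
    (t : ℝ) : IsWeaklyDivFree (slabPhys hab w t) := by
  by_cases ht : t ∈ Icc a b
  swap
  · have : slabPhys hab w t = 0 := by funext x; exact slabPhys_of_not_mem hab w ht x
    rw [this]; exact isWeaklyDivFree_zero_pi
  have hfun : slabPhys hab w t = (heatFlow (⇑g) (t - a) -
      (oseenDuhamel 1 a (slabPhys hab U) (slabPhys hab w) t +
        oseenDuhamel 1 a (slabPhys hab w) (slabPhys hab U) t)) -
      oseenDuhamel 1 a (slabPhys hab w) (slabPhys hab w) t := by
    funext x
    rw [slab_perturbation_pointwise hab heq ht x, linOseen]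
    simp only [Pi.sub_apply, Pi.add_apply]
  rw [hfun]
  have hH : IsWeaklyDivFree (heatFlow (⇑g) (t - a)) :=
    isWeaklyDivFree_heatFlow_of_bound hg g.continuous (fun z => g.norm_coe_le_norm z) _
  have hB1 := isWeaklyDivFree_oseenDuhamel_slabPhys hab U w (s := a) ht.2
  have hB2 := isWeaklyDivFree_oseenDuhamel_slabPhys hab w U (s := a) ht.2
  have hB3 := isWeaklyDivFree_oseenDuhamel_slabPhys hab w w (s := a) ht.2
  -- continuity (hence local integrability) of every piece
  have hHc : Continuous (heatFlow (⇑g) (t - a)) :=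
    (continuous_uncurry_heatFlow g.continuous (fun z => g.norm_coe_le_norm z)).comp
      (continuous_const.prodMk continuous_id)
  have hBc : ∀ W₁ W₂ : (Icc a b) × E →ᵇ E,
      Continuous (oseenDuhamel 1 a (slabPhys hab W₁) (slabPhys hab W₂) t) := fun W₁ W₂ =>
    ((continuousOn_uncurry_oseenDuhamel_slabPhys hab W₁ W₂).comp_continuous
      (continuous_const.prodMk continuous_id) (fun y => ⟨ht, mem_univ _⟩) : _)
  have hL : IsWeaklyDivFree (oseenDuhamel 1 a (slabPhys hab U) (slabPhys hab w) t +
      oseenDuhamel 1 a (slabPhys hab w) (slabPhys hab U) t) :=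
    hB1.add_of_continuous hB2 (hBc U w) (hBc w U)
  refine (hH.sub_of_locallyIntegrable hL hHc.locallyIntegrable
    ((hBc U w).add (hBc w U)).locallyIntegrable).sub_of_locallyIntegrable hB3
    ((hHc.sub ((hBc U w).add (hBc w U))).locallyIntegrable) (hBc w w).locallyIntegrable

/-- **Uniform modulus of continuity in space of the Duhamel term of bounded fields** (depends on
the fields only through their bounds): for `ν = 1`, `p, q` jointly a.e.-measurable and bounded by
`Mp, Mq` on `(s, T) × E`, `s < t ≤ T` and `ε > 0` there is `η > 0` with
`‖B_s(p,q)(t)(x) − B_s(p,q)(t)(x')‖ ≤ ε` whenever `‖x − x'‖ < η`.  Proof: split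
`B_s(t) = e^{δΔ} B_s(t−δ) + B_{t−δ}(t)` (`oseenDuhamel_eq_heatExtension_add_of_slab`); the second
piece is `O(√δ)` in sup norm, the first is Lipschitz in `x` with constant `2^{d/2} δ^{-1/2} ‖B_s(t−δ)‖_∞`
(`norm_heatExtension_sub_le_of_bounded`). [cite: KochNadirashviliSereginSverak2009, §3 (3.10)] -/
theorem exists_forall_norm_oseenDuhamel_sub_le_space {s T Mp Mq : ℝ} (hMp : 0 ≤ Mp) (hMq : 0 ≤ Mq)
    {t : ℝ} (hst : s < t) (htT : t ≤ T) {ε : ℝ} (hε : 0 < ε) :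
    ∃ η : ℝ, 0 < η ∧ ∀ p q : ℝ → E → E,
      AEStronglyMeasurable (uncurry p) ((volume : Measure (ℝ × E)).restrict (Ioo s T ×ˢ univ)) →
      AEStronglyMeasurable (uncurry q) ((volume : Measure (ℝ × E)).restrict (Ioo s T ×ˢ univ)) →
      (∀ τ ∈ Ioo s T, ∀ y, ‖p τ y‖ ≤ Mp) → (∀ τ ∈ Ioo s T, ∀ y, ‖q τ y‖ ≤ Mq) →
      ∀ x x', ‖x - x'‖ < η → ‖oseenDuhamel 1 s p q t x - oseenDuhamel 1 s p q t x'‖ ≤ ε := by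
  have hC₀ := oseenSliceConst_pos (E := E)
  -- the late window `δ`
  set κ : ℝ := ε / (8 * oseenSliceConst E * (Mp * Mq + 1)) with hκ
  have hκ0 : 0 < κ := by positivity
  set δ : ℝ := min ((t - s) / 2) (κ ^ 2) with hδ
  have hδ0 : 0 < δ := lt_min (by linarith) (by positivity)
  have hδts : δ < t - s := (min_le_left _ _).trans_lt (by linarith)
  have hsqrt : Real.sqrt δ ≤ κ := by
    rw [Real.sqrt_le_left hκ0.le]; exact min_le_right _ _
  have hlate_bd : oseenSliceConst E * (Mp * Mq) * (2 * Real.sqrt δ) ≤ ε / 4 := by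
    calc oseenSliceConst E * (Mp * Mq) * (2 * Real.sqrt δ)
        ≤ oseenSliceConst E * (Mp * Mq) * (2 * κ) := by gcongr
      _ = ε / 4 * (Mp * Mq / (Mp * Mq + 1)) := by rw [hκ]; field_simp; ring
      _ ≤ ε / 4 * 1 := by gcongr; rw [div_le_one (by positivity)]; linarith
      _ = ε / 4 := mul_one _
  set θ : ℝ := t - δ with hθ
  have hsθ : s < θ := by rw [hθ]; linarith
  have hθt : θ < t := by rw [hθ]; linarith
  -- the Lipschitz radius
  set Cf : ℝ := oseenSliceConst E * (Mp * Mq) * (2 * Real.sqrt (T - s)) with hCf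
  have hCf0 : 0 ≤ Cf := by positivity
  set Lip : ℝ := (2 : ℝ) ^ ((Module.finrank ℝ E : ℝ) / 2) * δ ^ (-(1 / 2 : ℝ)) * Cf with hLip
  have hLip0 : 0 ≤ Lip := by positivity
  set η : ℝ := ε / 2 / (Lip + 1) with hη
  have hη0 : 0 < η := by positivity
  refine ⟨η, hη0, fun p q hpm hqm hp hq x x' hxx' => ?_⟩
  -- bounds on the sub-slab `(s, t)`
  have hp' : ∀ τ ∈ Ioo s t, ∀ y, ‖p τ y‖ ≤ Mp := fun τ hτ y => hp τ ⟨hτ.1, hτ.2.trans_le htT⟩ y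
  have hq' : ∀ τ ∈ Ioo s t, ∀ y, ‖q τ y‖ ≤ Mq := fun τ hτ y => hq τ ⟨hτ.1, hτ.2.trans_le htT⟩ y
  -- the early piece `f = B_s(p,q)(θ)` is bounded and continuous
  set f : E → E := oseenDuhamel 1 s p q θ with hf
  have hfbd : ∀ y, ‖f y‖ ≤ Cf := fun y => by
    refine (norm_oseenDuhamel_le_const hsθ.le (fun τ hτ z => hp τ ⟨hτ.1, hτ.2.trans
      (hθt.trans_le htT)⟩ z) (fun τ hτ z => hq τ ⟨hτ.1, hτ.2.trans (hθt.trans_le htT)⟩ z) y).trans ?_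
    rw [hCf]; gcongr; linarith [hθt.le.trans htT]
  have hM : 0 ≤ max Mp Mq := le_max_of_le_left hMp
  have hfc : Continuous f := continuous_oseenDuhamel_slice one_pos hM hpm hqm
    (fun τ hτ y => (hp τ hτ y).trans (le_max_left _ _))
    (fun τ hτ y => (hq τ hτ y).trans (le_max_right _ _)) hsθ (hθt.le.trans htT)
  -- the split at both points
  have hsplit : ∀ z, oseenDuhamel 1 s p q t z =
      UnboundedOperators.heatExtension f δ z + oseenDuhamel 1 θ p q t z := fun z => by
    have h := oseenDuhamel_eq_heatExtension_add_of_slab one_pos hpm hqm hMp hMq hp hq hsθ hθt htT z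
    rw [h, hf, hθ, show 1 * (t - (t - δ)) = δ by ring]
  have hlate : ∀ z, ‖oseenDuhamel 1 θ p q t z‖ ≤ ε / 4 := fun z => by
    refine (norm_oseenDuhamel_le_const hθt.le (fun τ hτ y => hp' τ ⟨hsθ.trans hτ.1, hτ.2⟩ y)
      (fun τ hτ y => hq' τ ⟨hsθ.trans hτ.1, hτ.2⟩ y) z).trans ?_
    rw [hθ, show t - (t - δ) = δ by ring]; exact hlate_bd
  have hheat : ‖UnboundedOperators.heatExtension f δ x - UnboundedOperators.heatExtension f δ x'‖ ≤
      ε / 2 := by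
    have h := UnboundedOperators.norm_heatExtension_sub_le_of_bounded hfc.aestronglyMeasurable
      hfbd hδ0 x' x
    calc _ ≤ Lip * ‖x - x'‖ := by rw [hLip]; exact h
      _ ≤ Lip * η := mul_le_mul_of_nonneg_left hxx'.le hLip0
      _ = ε / 2 * (Lip / (Lip + 1)) := by rw [hη]; ring
      _ ≤ ε / 2 * 1 := by gcongr; rw [div_le_one (by positivity)]; linarith
      _ = ε / 2 := mul_one _
  rw [hsplit x, hsplit x']
  calc ‖UnboundedOperators.heatExtension f δ x + oseenDuhamel 1 θ p q t x -
        (UnboundedOperators.heatExtension f δ x' + oseenDuhamel 1 θ p q t x')‖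
      = ‖(UnboundedOperators.heatExtension f δ x - UnboundedOperators.heatExtension f δ x') +
          oseenDuhamel 1 θ p q t x - oseenDuhamel 1 θ p q t x'‖ := by congr 1; abel
    _ ≤ ‖UnboundedOperators.heatExtension f δ x - UnboundedOperators.heatExtension f δ x'‖ +
          ‖oseenDuhamel 1 θ p q t x‖ + ‖oseenDuhamel 1 θ p q t x'‖ :=
        (norm_sub_le _ _).trans (by gcongr; exact norm_add_le _ _)
    _ ≤ ε / 2 + ε / 4 + ε / 4 := by gcongr <;> first | exact hheat | exact hlate _
    _ = ε := by ring

end Qualitative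

/-! ### Bounded continuous data from bare functions -/

section BCFData

variable {X F : Type*} [TopologicalSpace X] [NormedAddCommGroup F]

open Classical in
/-- The bounded continuous function defined by a continuous bounded bare function `g : X → F`
(and `0` if `g` is not continuous and bounded): a total wrapper around
`BoundedContinuousFunction.ofNormedAddCommGroup`, used to feed data given as bare functions with
side conditions into operators on `X →ᵇ F`. [folklore] -/
def bcfOfBounded (g : X → F) : X →ᵇ F :=
  if h : Continuous g ∧ ∃ B : ℝ, ∀ x, ‖g x‖ ≤ B then
    BoundedContinuousFunction.ofNormedAddCommGroup g h.1 (Classical.choose h.2)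
      (Classical.choose_spec h.2)
  else 0

/-- `bcfOfBounded g` is `g` for `g` continuous and bounded. [folklore] -/
theorem bcfOfBounded_coe {g : X → F} (hg : Continuous g) {B : ℝ} (hB : ∀ x, ‖g x‖ ≤ B) :
    (⇑(bcfOfBounded g) : X → F) = g := by
  have h : Continuous g ∧ ∃ B : ℝ, ∀ x, ‖g x‖ ≤ B := ⟨hg, B, hB⟩
  simp only [bcfOfBounded, dif_pos h, BoundedContinuousFunction.coe_ofNormedAddCommGroup]

/-- The sup norm of `bcfOfBounded g` is at most any pointwise bound of `g` (on a nonempty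
space). [folklore] -/
theorem norm_bcfOfBounded_le [Nonempty X] {g : X → F} (hg : Continuous g) {B : ℝ}
    (hB : ∀ x, ‖g x‖ ≤ B) : ‖bcfOfBounded g‖ ≤ B := by
  have hB0 : 0 ≤ B := (norm_nonneg _).trans (hB (Classical.arbitrary X))
  refine (BoundedContinuousFunction.norm_le hB0).2 fun x => ?_
  rw [bcfOfBounded_coe hg hB]; exact hB x

/-- `bcfOfBounded` is additive on continuous bounded functions. [folklore] -/
theorem bcfOfBounded_add {g₁ g₂ : X → F} (h1 : Continuous g₁) (b1 : ∃ B : ℝ, ∀ x, ‖g₁ x‖ ≤ B)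
    (h2 : Continuous g₂) (b2 : ∃ B : ℝ, ∀ x, ‖g₂ x‖ ≤ B) :
    bcfOfBounded (g₁ + g₂) = bcfOfBounded g₁ + bcfOfBounded g₂ := by
  obtain ⟨B₁, hB₁⟩ := b1
  obtain ⟨B₂, hB₂⟩ := b2
  ext1 x
  have hs : ∀ x, ‖(g₁ + g₂) x‖ ≤ B₁ + B₂ := fun x =>
    (norm_add_le _ _).trans (add_le_add (hB₁ x) (hB₂ x))
  rw [BoundedContinuousFunction.coe_add, bcfOfBounded_coe (h1.add h2) hs, bcfOfBounded_coe h1 hB₁,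
    bcfOfBounded_coe h2 hB₂]

/-- `bcfOfBounded` commutes with subtraction on continuous bounded functions. [folklore] -/
theorem bcfOfBounded_sub {g₁ g₂ : X → F} (h1 : Continuous g₁) (b1 : ∃ B : ℝ, ∀ x, ‖g₁ x‖ ≤ B)
    (h2 : Continuous g₂) (b2 : ∃ B : ℝ, ∀ x, ‖g₂ x‖ ≤ B) :
    bcfOfBounded (g₁ - g₂) = bcfOfBounded g₁ - bcfOfBounded g₂ := by
  obtain ⟨B₁, hB₁⟩ := b1
  obtain ⟨B₂, hB₂⟩ := b2
  ext1 x
  have hs : ∀ x, ‖(g₁ - g₂) x‖ ≤ B₁ + B₂ := fun x =>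
    (norm_sub_le _ _).trans (add_le_add (hB₁ x) (hB₂ x))
  rw [BoundedContinuousFunction.coe_sub, bcfOfBounded_coe (h1.sub h2) hs, bcfOfBounded_coe h1 hB₁,
    bcfOfBounded_coe h2 hB₂]

/-- `bcfOfBounded` commutes with real scalar multiplication on continuous bounded functions.
[folklore] -/
theorem bcfOfBounded_smul [NormedSpace ℝ F] (r : ℝ) {g : X → F} (h1 : Continuous g)
    (b1 : ∃ B : ℝ, ∀ x, ‖g x‖ ≤ B) : bcfOfBounded (r • g) = r • bcfOfBounded g := by
  obtain ⟨B₁, hB₁⟩ := b1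
  have hc' : Continuous (r • g) := h1.const_smul r
  have hs : ∀ x, ‖(r • g) x‖ ≤ ‖r‖ * B₁ := fun x => by
    rw [Pi.smul_apply, norm_smul]; exact mul_le_mul_of_nonneg_left (hB₁ x) (norm_nonneg _)
  ext1 x
  rw [BoundedContinuousFunction.coe_smul, bcfOfBounded_coe hc' hs, bcfOfBounded_coe h1 hB₁]
  rfl

/-- `bcfOfBounded 0 = 0`. [folklore] -/
@[simp] theorem bcfOfBounded_zero : bcfOfBounded (0 : X → F) = 0 := by
  ext1 x; rw [bcfOfBounded_coe continuous_zero (B := 0) (fun x => by simp)]; rfl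

end BCFData

end Literature.Analysis.FluidPDE

end
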